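import Summits.CriticalPhenomena.PercolationContinuityZ3.Theorems.PercAnnulusCrossingIICBallBypassRider
import Summits.CriticalPhenomena.PercolationContinuityZ3.Theorems.PercAnnulusCrossingIICNearPoint
import Summits.CriticalPhenomena.PercolationContinuityZ3.Theorems.PercAnnulusCrossingIICTwoWindowsInsideDecoupling
import Summits.CriticalPhenomena.PercolationContinuityZ3.Theorems.PercAnnulusCrossingIICCondFatGeometry
import HarnessLib

/-!
# The ball bypass with a BALL rider: `c_U·P({0 ↔ Λ_y(m)} ∩ {0 ↔ 𝔅} ∩ A_N) ≤ P(Λ(m) ↔ ∂ⁱⁿΛ(a−1))·P({0 ↔ 𝔅} ∩ A_N)` (lane RSW3, p1 gen 25)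

builds on p205010 (kernel theorem, internal audit signed; external expert review pending) — NOT used in this file (every `d`, `p`;
the robust glued annulus `CU⁺_l`).

RSW3 lane (LANE 3 `prim-rsw3`), seat `prim-rsw3-p1` (gen 25).  Helper file (`--supports stmt-CriticalPhenomena-4575`); no definitions,
no sorries.  Memo `run/shared/lean/prim/rsw3/P1-QM.md` §38.8.

`…IICPointWindowPrices` (`real_rootHit_inter_pointHit_inter_siteToBoundary_le`) translated the ball bypass with riders
(`…IICBallBypassRider`) to a ball centred at `y` with the rider `{x}`.  Here the rider is an ARBITRARY FINITE SET `𝔅` whose sites `t` have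
`t − y ∉ Λ(la − 1)` — e.g. a far ball `Λ_z(m')`:
**`c_U·P_p({0 ↔ Λ_y(m) in Λ(N)} ∩ {0 ↔ 𝔅 in Λ(N)} ∩ A_N) ≤ P_p(∃ q ∈ Λ(m), ∃ s ∈ ∂ⁱⁿΛ(a−1), q ↔ s in Λ(a−1)) · P_p({0 ↔ 𝔅 in Λ(N)} ∩ A_N)`**
(`2 ≤ a`, `m ≤ a − 2`, `y ∉ Λ(la−1)`, `la + ‖y‖ ≤ N`).  This is price (a) of the planned decoupling of a far window from
`{C(0) ∩ Λ_z(m') ≠ ∅}` (memo §38.8): the piece `V₀ ∩ OC^𝔅_N ∩ A_N` of the cluster-identity split costs the window's link times the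
ball two-point-with-arm (`…IICBallTwoArms`).

* **`real_rootHit_inter_setHit_inter_siteToBoundary_le`** — the ball bypass with the rider `𝔅`, root at the origin.
References: H. Kesten, PTRF 73 (1986) §2; D. Basu, A. Sapozhnikov, ECP 22 (2017) Thm. 1.1; G. Grimmett, *Percolation* (1999) §1.6, §2.2.
-/

noncomputable section

namespace Summit.CriticalPhenomena.PercolationContinuityZ3.Theorems.Crossing

open MeasureTheory Filter Topology Literature.Probability.Percolation Literature.Probability.LatticeModels
open Literature.Probability.Percolation.DCT16
open Summit.CriticalPhenomena.PercolationContinuityZ3.Theorems.SurfaceTension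
open scoped Literature.Probability.Percolation

variable {d : ℕ}

/-- **THE BALL BYPASS WITH A FINITE RIDER SET, ROOT AT THE ORIGIN** (every `d`, `p`; `CU⁺_l(c_U)`, `l ≥ 2`, `c_U ≥ 0`; `2 ≤ a`, `m ≤ a − 2`;
`y ∉ Λ(la−1)`; `t − y ∉ Λ(la−1)` for every `t ∈ 𝔅`; `la + ‖y‖ ≤ N`):
**`c_U·P_p({0 ↔ Λ_y(m) in Λ(N)} ∩ {0 ↔ 𝔅 in Λ(N)} ∩ A_N) ≤ P_p(Λ(m) ↔ ∂ⁱⁿΛ(a−1) in Λ(a−1))·P_p({0 ↔ 𝔅 in Λ(N)} ∩ A_N)`**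
(`…IICBallBypassRider` translated by `−y`). [cite: Kesten1986, §2] [cite: BasuSapozhnikov2017ECP, Thm. 1.1] -/
theorem real_rootHit_inter_setHit_inter_siteToBoundary_le (p : unitInterval) {l : ℕ} (hl : 2 ≤ l) {cU : ℝ} (hcU : 0 ≤ cU)
    (hCU : ∀ a : ℕ, 1 ≤ a → ∀ E : Set (BondConfig (Site d)), IsUpperSet E → MeasurableSet E →
      cU * (bondPercolation (zdGraph d) p).real E ≤ (bondPercolation (zdGraph d) p).real (E ∩
        {ω : BondConfig (Site d) | ∀ t ∈ innerBoundary (zdGraph d) (box d a), ∀ s ∈ innerBoundary (zdGraph d) (box d (l * a)),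
        ∀ t' ∈ innerBoundary (zdGraph d) (box d a), ∀ s' ∈ innerBoundary (zdGraph d) (box d (l * a)),
        ω ∈ openConnIn (↑((box d (l * a) \ box d a) ∪ innerBoundary (zdGraph d) (box d a)) : Set (Site d)) t s →
        ω ∈ openConnIn (↑((box d (l * a) \ box d a) ∪ innerBoundary (zdGraph d) (box d a)) : Set (Site d)) t' s' →
        ω ∈ openConnIn (↑((box d (l * a) \ box d a) ∪ innerBoundary (zdGraph d) (box d a)) : Set (Site d)) s s'}))
    {a m N : ℕ} (ha : 2 ≤ a) (hma : m ≤ a - 2) (y : Site d) (T : Finset (Site d)) (hy : y ∉ box d (l * a - 1))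
    (hT : ∀ t ∈ T, t - y ∉ box d (l * a - 1)) (hN : l * a + Site.supNorm y ≤ N) :
    cU * (bondPercolation (zdGraph d) p).real
        ({ω | ∃ x₁ ∈ ({0} : Finset (Site d)), ∃ w ∈ (box d m).image (· + y), ω ∈ openConnIn (↑(box d N) : Set (Site d)) x₁ w} ∩
          {ω | ∃ x₁ ∈ ({0} : Finset (Site d)), ∃ q ∈ T, ω ∈ openConnIn (↑(box d N) : Set (Site d)) x₁ q} ∩
          siteToBoundary d N) ≤
      (bondPercolation (zdGraph d) p).real {ω : BondConfig (Site d) | ∃ q ∈ box d m, ∃ s ∈ innerBoundary (zdGraph d) (box d (a - 1)),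
          ω ∈ openConnIn (↑(box d (a - 1)) : Set (Site d)) q s} *
        (bondPercolation (zdGraph d) p).real
          ({ω | ∃ x₁ ∈ ({0} : Finset (Site d)), ∃ q ∈ T, ω ∈ openConnIn (↑(box d N) : Set (Site d)) x₁ q} ∩
            siteToBoundary d N) := by
  classical
  have harm : BondConfig.relabel (sym2Equiv (Site.shift y)) ⁻¹' siteToBoundary d N = DCT16.armEvent (-y) N := by
    rw [← preimage_shift_siteToBoundary (-y) N, neg_neg]
  have hpre : ∀ X : Finset (Site d), BondConfig.relabel (sym2Equiv (Site.shift y)) ⁻¹'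
      {ω | ∃ x₁ ∈ ({0} : Finset (Site d)), ∃ q ∈ X, ω ∈ openConnIn (↑(box d N) : Set (Site d)) x₁ q} =
      {ω | ∃ q ∈ X.image (· - y), ω ∈ openConnIn (↑((box d N).image (· - y)) : Set (Site d)) (-y) q} := by
    intro X
    rw [preimage_shift_exists_openConnIn, Finset.image_singleton, zero_sub]
    ext ω
    simp only [Set.mem_setOf_eq, Finset.mem_singleton, exists_eq_left]
  have hyn : -y ∉ box d (l * a - 1) := fun h => hy (by rwa [mem_box_iff_supNorm_le, Site.supNorm_neg, ← mem_box_iff_supNorm_le] at h)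
  have htransL : (bondPercolation (zdGraph d) p).real
        ({ω | ∃ x₁ ∈ ({0} : Finset (Site d)), ∃ w ∈ (box d m).image (· + y), ω ∈ openConnIn (↑(box d N) : Set (Site d)) x₁ w} ∩
          {ω | ∃ x₁ ∈ ({0} : Finset (Site d)), ∃ q ∈ T, ω ∈ openConnIn (↑(box d N) : Set (Site d)) x₁ q} ∩
          siteToBoundary d N) =
      (bondPercolation (zdGraph d) p).real ({ω | ∃ q ∈ box d m, ω ∈ openConnIn (↑((box d N).image (· - y)) : Set (Site d)) (-y) q} ∩
        (⋂ j ∈ ({0} : Finset ℕ), {ω | ∃ q ∈ T.image (· - y),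
          ω ∈ openConnIn (↑((box d N).image (· - y)) : Set (Site d)) (-y) q}) ∩ DCT16.armEvent (-y) N) := by
    rw [← bondPercolation_real_preimage_shift y p, Set.preimage_inter, Set.preimage_inter, hpre, hpre,
      image_add_image_sub, harm]
    congr 2; ext ω; simp only [Set.mem_inter_iff, Set.mem_iInter, Finset.mem_singleton, forall_eq]
  have htransR : (bondPercolation (zdGraph d) p).real
        ({ω | ∃ x₁ ∈ ({0} : Finset (Site d)), ∃ q ∈ T, ω ∈ openConnIn (↑(box d N) : Set (Site d)) x₁ q} ∩
          siteToBoundary d N) =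
      (bondPercolation (zdGraph d) p).real ((⋂ j ∈ ({0} : Finset ℕ), {ω | ∃ q ∈ T.image (· - y),
          ω ∈ openConnIn (↑((box d N).image (· - y)) : Set (Site d)) (-y) q}) ∩ DCT16.armEvent (-y) N) := by
    rw [← bondPercolation_real_preimage_shift y p, Set.preimage_inter, hpre, harm]
    congr 2; ext ω; simp only [Set.mem_iInter, Finset.mem_singleton, forall_eq]
  rw [htransL, htransR]
  refine real_ballHit_inter_biInter_inter_armEvent_le p hl hcU hCU ha hma (-y) hyn (by rw [Site.supNorm_neg]; exact hN) ?_ ?_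
    ({0} : Finset ℕ) (fun _ => T.image (· - y)) ?_
  · intro z hz
    obtain ⟨w, hw, rfl⟩ := Finset.mem_image.1 (Finset.mem_coe.1 hz)
    show w - y - -y ∈ box d N
    rw [sub_neg_eq_add, sub_add_cancel]; exact hw
  · intro z hz
    refine Finset.mem_coe.2 (Finset.mem_image.2 ⟨z + y, ?_, add_sub_cancel_right z y⟩)
    have h1 := mem_box_iff_supNorm_le.1 (Finset.mem_coe.1 hz)
    have h2 := Site.supNorm_add_le z y
    exact mem_box_iff_supNorm_le.2 (by omega)
  · intro j _ q hq
    obtain ⟨t, ht, rfl⟩ := Finset.mem_image.1 hq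
    exact hT t ht

end Summit.CriticalPhenomena.PercolationContinuityZ3.Theorems.Crossing

end
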